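import Summits.Langlands.Langlands.Theses.TrigonalHeartLimit
import Literature.NumberTheory.Automorphic.AlgebraicityTwist
import Literature.NumberTheory.Automorphic.InfinityTypeNeg
import Literature.NumberTheory.Automorphic.GLnAdelicStructureProofs
import Literature.FieldTheory.AlgClosed.PadicAlgClEquivComplex

/-!
# `TrigonalHeartLimit.OddResidualAutomorphyAtThree` from its two sub-statements (typed decomposition,
# crux item stmt-Langlands-13672; strategist planner-cstrat-stmt-Langlands-13672-r1-0, 2026-08-17)

`X := OddResidualAutomorphyAtThree` — Serre's conjecture at `p = 3` in the summit's REGULAR-algebraic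
(Clozel) / HLTT idiom: an RA cuspidal `π` on `GL₂(𝔸_ℚ)`, `O ⊆ ℂ`, `ι' : O → k`, with
`∏ (X - q^{1/2} α_j) ∈ O[X]` reducing to `charpoly τ(Frob_v)` a.e. — is cut into

* `X_A := SerreKWAutomorphicGL2` — VERBATIM the vetted sibling crux stmt-Langlands-12944 of route
  PhantomRMYoshida (Serre's conjecture for `GL₂/ℚ`, every `p`, Buzzard–Gee L-normalisation, ANY
  weight: an L-algebraic cuspidal `π₂` whose L-normalised Satake polynomials
  `arithFrobPolyOfSatake ι q 1 a = ∏ (X - ι⁻¹(a_j⁻¹))` are `p`-integral with reduction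
  `charpoly σ̄(Frob_v)`), PROVED in the tree modulo the named fact `khare_wintenberger`
  (Theorems/PhantomRMYoshidaSerreKWAutomorphicGL2.lean, p87561); re-filing the identical statement
  attaches this route to that item (dedup);
* `X_B := ResidualWeightRaisingAtThree` — RESIDUAL WEIGHT RAISING at `p = 3` (Deligne–Serre
  `f ↦ f · E₄`, `E₄ ≡ 1 (mod 3)`, + the Deligne–Serre lifting lemma, in automorphic clothing; KW-free,
  a theorem in print): at a fixed ODD irreducible residue `τ`, an L-algebraic cuspidal `π` of
  `GL₂(𝔸_ℚ)` carrying the residual datum may be replaced by one with a REGULAR L-algebraic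
  infinity type carrying the same datum (oddness of `τ` forces an irregular `π` to be of
  holomorphic weight-one type, by the parity of its central character);

with the sorry-free assembly `OddResidualAutomorphyAtThree_of_subs : X_A → X_B → X`: choose
`ι : ℚ̄₃ ≃ ℂ` (Steinitz) and a residue map `red : 𝒪_{ℚ̄₃} → k` (CONSTRUCTED here: the residue
field of `𝒪_{ℚ̄₃}` is algebraic over `𝔽₃` — clear denominators and the `3`-content of a
`ℚ₃`-relation —, then `IsAlgClosed.lift`); apply `X_A` at `p = 3`; repackage; raise the weight
(`X_B`); then RENORMALISE from Buzzard–Gee's L-normalisation to Clozel's regular-algebraic HLTT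
normalisation demanded by `X`: contragredient (Satake `a ↦ a⁻¹`, infinity type `T ↦ T.neg`)
followed by `⊗ |det|^{1/2}` (Satake `· q^{-1/2}`, infinity type `twist (1/2)`), which is
C-algebraic (`n = 2`) and regular; transport the coefficients along `𝒪_{ℚ̄₃} ≃ O := ι(𝒪_{ℚ̄₃})`
with `ι' := red ∘ ι⁻¹`, and check `∏ (X - √q · (q^{-1/2} a_j⁻¹)) = ∏ (X - a_j⁻¹) =
ι(arithFrobPolyOfSatake ι q 1 a)`.
-/

noncomputable section

set_option linter.dupNamespace false

namespace Summit.Langlands.Langlands.Theorems.TrigonalHeartLimitOddResidualAutomorphyAtThreeSplit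

open scoped BigOperators Topology Classical Matrix
open Filter Set Function
open Summit.Langlands.Langlands.Theses.TrigonalHeartLimit (OddResidualAutomorphyAtThree)

open Literature.NumberTheory.Automorphic Literature.NumberTheory.GaloisRepresentations
  IsDedekindDomain Polynomial

/-! ### A residue map `𝒪_{ℚ̄₃} → k` exists for every algebraically closed `k` of characteristic `3` -/

namespace ResidueMap

open scoped NNReal

/-- `ℤ₃ → 𝒪_{ℚ̄₃}` (the valuation of `ℚ̄₃` extends that of `ℚ₃`). -/
def intToInteger : ℤ_[3] →+* Valued.integer (PadicAlgCl 3) :=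
  ((algebraMap ℚ_[3] (PadicAlgCl 3)).comp PadicInt.Coe.ringHom).codRestrict _ fun z => by
    rw [Valuation.mem_integer_iff, PadicAlgCl.valuation_def]
    have h : ‖((z : ℚ_[3]) : PadicAlgCl 3)‖ ≤ 1 := by
      rw [PadicAlgCl.norm_extends]; exact PadicInt.norm_le_one z
    exact_mod_cast h

@[simp] theorem coe_intToInteger (z : ℤ_[3]) :
    ((intToInteger z : Valued.integer (PadicAlgCl 3)) : PadicAlgCl 3) =
      algebraMap ℚ_[3] (PadicAlgCl 3) (z : ℚ_[3]) := rfl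

theorem mem_maximalIdeal_of_norm_lt_one {y : Valued.integer (PadicAlgCl 3)}
    (hy : ‖(y : PadicAlgCl 3)‖ < 1) :
    y ∈ IsLocalRing.maximalIdeal (Valued.integer (PadicAlgCl 3)) := by
  rw [IsLocalRing.mem_maximalIdeal, mem_nonunits_iff,
    Valuation.Integer.not_isUnit_iff_valuation_lt_one, PadicAlgCl.valuation_def]
  exact_mod_cast hy

theorem three_mem_maximalIdeal :
    ((3 : ℕ) : Valued.integer (PadicAlgCl 3)) ∈ IsLocalRing.maximalIdeal (Valued.integer (PadicAlgCl 3)) := by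
  apply mem_maximalIdeal_of_norm_lt_one
  rw [show (((3 : ℕ) : Valued.integer (PadicAlgCl 3)) : PadicAlgCl 3) = ((3 : ℕ) : PadicAlgCl 3) from rfl,
    ← PadicAlgCl.valuation_coe, PadicAlgCl.valuation_p 3]
  have h2 : (1 : ℝ≥0) / 3 < 1 := by
    rw [div_lt_one (by norm_num)]; norm_num
  exact_mod_cast h2

instance charP_residueField :
    CharP (IsLocalRing.ResidueField (Valued.integer (PadicAlgCl 3))) 3 :=
  (CharP.charP_iff_prime_eq_zero (by norm_num : Nat.Prime 3)).2 (by
    rw [← map_natCast (IsLocalRing.residue (Valued.integer (PadicAlgCl 3))),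
      IsLocalRing.residue_eq_zero_iff]
    exact three_mem_maximalIdeal)

/-- The `𝔽₃`-algebra structure of the residue field of `𝒪_{ℚ̄₃}`. -/
instance algebraZMod : Algebra (ZMod 3) (IsLocalRing.ResidueField (Valued.integer (PadicAlgCl 3))) :=
  ZMod.algebra _ 3

/-- Ring maps out of `ℤ₃` into an `𝔽₃`-algebra (in which `3 = 0`) factor through `ℤ₃ → 𝔽₃`. -/
theorem ringHom_eq_comp_toZMod {R : Type*} [CommRing R] [CharP R 3] [Algebra (ZMod 3) R]
    (χ : ℤ_[3] →+* R) : χ = (algebraMap (ZMod 3) R).comp (PadicInt.toZMod (p := 3)) := by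
  -- every ring map `χ' : ℤ₃ → R` is `z ↦ (toZMod z).val`, because `χ' 3 = 0`
  have key : ∀ (χ' : ℤ_[3] →+* R) (z : ℤ_[3]), χ' z = ((PadicInt.toZMod z).val : R) := by
    intro χ' z
    have hmem := PadicInt.toZMod_spec z
    rw [PadicInt.maximalIdeal_eq_span_p, Ideal.mem_span_singleton] at hmem
    obtain ⟨c, hc⟩ := hmem
    have h3 : χ' ((3 : ℕ) : ℤ_[3]) = 0 := by
      rw [map_natCast]; exact CharP.cast_eq_zero R 3
    have hsub : χ' z - χ' ((PadicInt.toZMod z).cast) = 0 := by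
      rw [← map_sub, hc, map_mul, h3, zero_mul]
    rw [sub_eq_zero] at hsub
    rw [hsub, ZMod.cast_eq_val, map_natCast]
  ext z
  rw [key χ z, key ((algebraMap (ZMod 3) R).comp (PadicInt.toZMod (p := 3))) z]

/-- **The residue field of `𝒪_{ℚ̄₃}` is algebraic over `𝔽₃`.**  For `x ∈ 𝒪_{ℚ̄₃}` pick a non-zero
relation `f(x) = 0` over `ℚ₃` (`x` is algebraic), clear denominators (`integerNormalization`) and
divide by the `3`-content, so that some coefficient is a `3`-adic unit; the reduction of this
primitive relation is a non-zero relation over `𝔽₃` for the residue of `x`. -/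
theorem isAlgebraic_residue (x : Valued.integer (PadicAlgCl 3)) :
    IsAlgebraic (ZMod 3) (IsLocalRing.residue (Valued.integer (PadicAlgCl 3)) x) := by
  classical
  -- algebra tower ℤ₃ → ℚ₃ → ℚ̄₃ (instances from `AlgebraicClosure`)
  have halg : ∀ z : ℤ_[3], algebraMap ℤ_[3] (PadicAlgCl 3) z = algebraMap ℚ_[3] (PadicAlgCl 3) (z : ℚ_[3]) := by
    intro z
    rw [IsScalarTower.algebraMap_apply ℤ_[3] ℚ_[3] (PadicAlgCl 3)]
    simp
  -- a non-zero relation over ℚ₃, made integral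
  have hxalg : IsAlgebraic ℚ_[3] (x : PadicAlgCl 3) := Algebra.IsAlgebraic.isAlgebraic _
  obtain ⟨f, hf0, hfx⟩ := hxalg
  set g : ℤ_[3][X] := IsLocalization.integerNormalization (nonZeroDivisors ℤ_[3]) f with hg
  have hgx : aeval (x : PadicAlgCl 3) g = 0 := IsLocalization.integerNormalization_aeval_eq_zero _ f hfx
  have hg0 : g ≠ 0 := fun h => hf0 ((IsFractionRing.integerNormalization_eq_zero_iff).mp h)
  -- the 3-content: minimal valuation `m` of a non-zero coefficient, attained at `i₀`
  have hsupp : g.support.Nonempty := Polynomial.support_nonempty.mpr hg0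
  obtain ⟨i₀, hi₀, hmin⟩ := g.support.exists_min_image (fun i => (g.coeff i).valuation) hsupp
  set m := (g.coeff i₀).valuation with hm
  have hdvd : ∀ i, (3 : ℤ_[3]) ^ m ∣ g.coeff i := by
    intro i
    by_cases hi : g.coeff i = 0
    · rw [hi]; exact dvd_zero _
    · have hle : m ≤ (g.coeff i).valuation := hmin i (Polynomial.mem_support_iff.mpr hi)
      rw [PadicInt.unitCoeff_spec hi]
      exact Dvd.dvd.mul_left (pow_dvd_pow _ hle) _
  obtain ⟨g', hg'⟩ := (Polynomial.C_dvd_iff_dvd_coeff _ _).mpr hdvd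
  -- the primitive relation still kills x
  have hg'x : aeval (x : PadicAlgCl 3) g' = 0 := by
    have h3 : (algebraMap ℤ_[3] (PadicAlgCl 3)) ((3 : ℤ_[3]) ^ m) ≠ 0 := by
      rw [map_pow]
      refine pow_ne_zero _ ?_
      rw [show (3 : ℤ_[3]) = ((3 : ℕ) : ℤ_[3]) by norm_cast, map_natCast]
      exact Nat.cast_ne_zero.mpr (by norm_num)
    have : (algebraMap ℤ_[3] (PadicAlgCl 3)) ((3 : ℤ_[3]) ^ m) * aeval (x : PadicAlgCl 3) g' = 0 := by
      rw [← Polynomial.aeval_C, ← map_mul, ← hg', hgx]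
    exact (mul_eq_zero.mp this).resolve_left h3
  -- its i₀-th coefficient is a unit
  have hunit : IsUnit (g'.coeff i₀) := by
    have hci₀ : g.coeff i₀ ≠ 0 := Polynomial.mem_support_iff.mp hi₀
    have e1 : g.coeff i₀ = (3 : ℤ_[3]) ^ m * g'.coeff i₀ := by
      rw [hg', Polynomial.coeff_C_mul]
    have e2 : g.coeff i₀ = (PadicInt.unitCoeff hci₀ : ℤ_[3]) * (3 : ℤ_[3]) ^ m := by
      rw [hm]; exact_mod_cast PadicInt.unitCoeff_spec hci₀
    have hpow : (3 : ℤ_[3]) ^ m ≠ 0 := pow_ne_zero _ (by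
      rw [show (3 : ℤ_[3]) = ((3 : ℕ) : ℤ_[3]) by norm_cast]
      exact_mod_cast (by norm_num : (3 : ℕ) ≠ 0))
    have h' : (3 : ℤ_[3]) ^ m * g'.coeff i₀ = (3 : ℤ_[3]) ^ m * (PadicInt.unitCoeff hci₀ : ℤ_[3]) :=
      calc (3 : ℤ_[3]) ^ m * g'.coeff i₀ = g.coeff i₀ := e1.symm
        _ = (PadicInt.unitCoeff hci₀ : ℤ_[3]) * (3 : ℤ_[3]) ^ m := e2
        _ = (3 : ℤ_[3]) ^ m * (PadicInt.unitCoeff hci₀ : ℤ_[3]) := mul_comm _ _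
    have : g'.coeff i₀ = (PadicInt.unitCoeff hci₀ : ℤ_[3]) := mul_left_cancel₀ hpow h'
    rw [this]
    exact Units.isUnit _
  -- reduce: the relation over 𝒪 and over the residue field
  have hO : Polynomial.eval₂ intToInteger x g' = 0 := by
    apply Subtype.val_injective
    rw [show ((Polynomial.eval₂ intToInteger x g' : Valued.integer (PadicAlgCl 3)) : PadicAlgCl 3) =
        Polynomial.eval₂ ((Valued.integer (PadicAlgCl 3)).subtype.comp intToInteger) (x : PadicAlgCl 3) g' from
        Polynomial.hom_eval₂ g' intToInteger (Valued.integer (PadicAlgCl 3)).subtype x]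
    have e : (Valued.integer (PadicAlgCl 3)).subtype.comp intToInteger = algebraMap ℤ_[3] (PadicAlgCl 3) := by
      ext z
      rw [halg z]
      rfl
    rw [e]
    exact hg'x
  have hκ : Polynomial.eval₂ ((IsLocalRing.residue (Valued.integer (PadicAlgCl 3))).comp intToInteger)
      (IsLocalRing.residue (Valued.integer (PadicAlgCl 3)) x) g' = 0 := by
    rw [← Polynomial.hom_eval₂, hO, map_zero]
  -- as a relation over 𝔽₃
  refine ⟨g'.map (PadicInt.toZMod (p := 3)), ?_, ?_⟩
  · intro h0
    have hc := congrArg (fun q => q.coeff i₀) h0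
    simp only [Polynomial.coeff_map, Polynomial.coeff_zero] at hc
    exact (hunit.map (PadicInt.toZMod (p := 3))).ne_zero hc
  · rw [Polynomial.aeval_def, Polynomial.eval₂_map,
      ← ringHom_eq_comp_toZMod ((IsLocalRing.residue (Valued.integer (PadicAlgCl 3))).comp intToInteger)]
    exact hκ

instance isAlgebraic_residueField :
    Algebra.IsAlgebraic (ZMod 3) (IsLocalRing.ResidueField (Valued.integer (PadicAlgCl 3))) := by
  refine ⟨fun y => ?_⟩
  obtain ⟨x, rfl⟩ := IsLocalRing.residue_surjective y
  exact isAlgebraic_residue x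

/-- **A residue map `red : 𝒪_{ℚ̄₃} →+* k` exists** for every algebraically closed field `k` of
characteristic `3`: reduction modulo the maximal ideal followed by an `𝔽₃`-embedding of the
(algebraic) residue field `𝔽̄₃` into `k` (`IsAlgClosed.lift`). -/
theorem nonempty_residueMap (k : Type*) [Field k] [CharP k 3] [IsAlgClosed k] :
    Nonempty (Valued.integer (PadicAlgCl 3) →+* k) := by
  letI : Algebra (ZMod 3) k := ZMod.algebra _ 3
  haveI : Module.IsTorsionFree (ZMod 3) (IsLocalRing.ResidueField (Valued.integer (PadicAlgCl 3))) :=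
    .of_smul_eq_zero fun r m h => by
      by_cases hr : r = 0
      · exact Or.inl hr
      · exact Or.inr (by rw [← inv_smul_smul₀ hr m, h, smul_zero])
  haveI : Module.IsTorsionFree (ZMod 3) k :=
    .of_smul_eq_zero fun r m h => by
      by_cases hr : r = 0
      · exact Or.inl hr
      · exact Or.inr (by rw [← inv_smul_smul₀ hr m, h, smul_zero])
  let φ : IsLocalRing.ResidueField (Valued.integer (PadicAlgCl 3)) →ₐ[ZMod 3] k := IsAlgClosed.lift
  exact ⟨φ.toRingHom.comp (IsLocalRing.residue (Valued.integer (PadicAlgCl 3)))⟩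

end ResidueMap

/-! ### Coefficient transport `𝒪_{ℚ̄₃} ≃ ι(𝒪_{ℚ̄₃}) ⊆ ℂ` and the two normalisation identities -/

/-- The image of the valuation ring `𝒪_{ℚ̄₃}` under `ι : ℚ̄₃ ≃+* ℂ`, a subring of `ℂ`. -/
def coeffSubring (ι : PadicAlgCl 3 ≃+* ℂ) : Subring ℂ :=
  (Valued.integer (PadicAlgCl 3)).map ι.toRingHom

/-- `𝒪_{ℚ̄₃} ≃+* ι(𝒪_{ℚ̄₃})`. -/
def coeffEquiv (ι : PadicAlgCl 3 ≃+* ℂ) : Valued.integer (PadicAlgCl 3) ≃+* coeffSubring ι :=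
  (Valued.integer (PadicAlgCl 3)).equivMapOfInjective ι.toRingHom ι.injective

@[simp] theorem coe_coeffEquiv (ι : PadicAlgCl 3 ≃+* ℂ) (x : Valued.integer (PadicAlgCl 3)) :
    ((coeffEquiv ι x : coeffSubring ι) : ℂ) = ι x := rfl

theorem subtype_comp_coeffEquiv (ι : PadicAlgCl 3 ≃+* ℂ) :
    (coeffSubring ι).subtype.comp (coeffEquiv ι).toRingHom =
      ι.toRingHom.comp (Valued.integer (PadicAlgCl 3)).subtype := by
  ext x; rfl

/-- `ι (arithFrobPolyOfSatake ι q 1 a) = ∏_{b ∈ a} (X - b⁻¹)` (Buzzard–Gee's L-normalisation, `m = 1`). -/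
theorem map_arithFrobPolyOfSatake_one (ι : PadicAlgCl 3 ≃+* ℂ) (q : ℕ) (a : Multiset ℂ) :
    (arithFrobPolyOfSatake ι q 1 a).map ι.toRingHom = (a.map fun b => X - C b⁻¹).prod := by
  simp [arithFrobPolyOfSatake, Polynomial.map_multiset_prod, Multiset.map_map]

/-- `√q · q^{-1/2} = 1` in `ℂ` for `q ≥ 1`. -/
theorem sqrt_mul_cpow_neg_half {q : ℕ} (hq : 0 < q) :
    ((Real.sqrt q : ℝ) : ℂ) * ((q : ℂ) ^ (-(((1 / 2 : ℝ) : ℝ) : ℂ))) = 1 := by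
  have hq0 : (0 : ℝ) ≤ q := Nat.cast_nonneg q
  have hqC : (q : ℂ) ≠ 0 := Nat.cast_ne_zero.mpr hq.ne'
  have h1 : ((Real.sqrt q : ℝ) : ℂ) = (q : ℂ) ^ (((1 / 2 : ℝ) : ℝ) : ℂ) := by
    rw [Real.sqrt_eq_rpow, Complex.ofReal_cpow hq0]
    push_cast
    ring_nf
  rw [h1, Complex.cpow_neg, mul_inv_cancel₀]
  exact Complex.cpow_ne_zero_iff.mpr (Or.inl hqC)

/-! ### Assembly -/

/-- **`OddResidualAutomorphyAtThree` from its two sub-statements** (hypotheses inlined verbatim: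
`SerreKWAutomorphicGL2` = item stmt-Langlands-12944 of route PhantomRMYoshida, and
`ResidualWeightRaisingAtThree`), sorry-free, axioms `propext`/`Classical.choice`/`Quot.sound`.
The route's glue item `OddResidualAutomorphyAtThreeOfSubs := SerreKWAutomorphicGL2 →
ResidualWeightRaisingAtThree → OddResidualAutomorphyAtThree` closes by
`fun hA hB => OddResidualAutomorphyAtThree_of_subs hA hB` (definitional unfolding).
[cite: BuzzardGeeLMS2014, §3.1 and §5.3] [cite: Clozel1990, Déf. 1.8 and 3.12] -/
theorem OddResidualAutomorphyAtThree_of_subs :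
    (∀ (p : ℕ) [Fact p.Prime] (k : Type) [Field k] [CharP k p] [IsAlgClosed k] [TopologicalSpace k] [DiscreteTopology k] (red : Valued.integer (PadicAlgCl p) →+* k) (σ : Literature.NumberTheory.GaloisRepresentations.FramedGaloisRep ℚ k 2), σ.IsOdd → σ.toGaloisRep.IsIrreducible → ∀ (hcpt₂ : Literature.NumberTheory.Automorphic.isCompact_glFiniteIntegralLevel 2 ℚ) (ι : PadicAlgCl p ≃+* ℂ), ∃ π₂ : Literature.NumberTheory.Automorphic.CuspidalAutomorphicRepData 2 ℚ hcpt₂, π₂.1.IsLAlgebraic ∧ ∀ᶠ v : IsDedekindDomain.HeightOneSpectrum (NumberField.RingOfIntegers ℚ) in Filter.cofinite, ∃ (a : Multiset ℂ) (P : Polynomial (Valued.integer (PadicAlgCl p))) (Pb : Polynomial k), π₂.1.HasSatakeParamAt v a ∧ P.map (Valued.integer (PadicAlgCl p)).subtype = Literature.NumberTheory.Automorphic.arithFrobPolyOfSatake ι v.residueCard 1 a ∧ σ.IsUnramifiedAt v ∧ σ.HasFrobCharpolyAt v Pb ∧ P.map red = Pb) →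
    (∀ {k : Type} [Field k] [CharP k 3] [IsAlgClosed k] [TopologicalSpace k] [DiscreteTopology k] (red : Valued.integer (PadicAlgCl 3) →+* k) (ι : PadicAlgCl 3 ≃+* ℂ) (τ : Literature.NumberTheory.GaloisRepresentations.FramedGaloisRep ℚ k 2), τ.toGaloisRep.IsIrreducible → Literature.NumberTheory.GaloisRepresentations.FramedGaloisRep.IsOdd τ → ∀ (hQ : Literature.NumberTheory.Automorphic.isCompact_glFiniteIntegralLevel 2 ℚ) (π : Literature.NumberTheory.Automorphic.CuspidalAutomorphicRepData 2 ℚ hQ), π.1.IsLAlgebraic → (∀ᶠ v : IsDedekindDomain.HeightOneSpectrum (NumberField.RingOfIntegers ℚ) in Filter.cofinite, ∃ (a : Multiset ℂ) (P : Polynomial (Valued.integer (PadicAlgCl 3))), π.1.HasSatakeParamAt v a ∧ P.map (Valued.integer (PadicAlgCl 3)).subtype = Literature.NumberTheory.Automorphic.arithFrobPolyOfSatake ι v.residueCard 1 a ∧ τ.HasFrobCharpolyAt v (P.map red)) → ∃ (π' : Literature.NumberTheory.Automorphic.CuspidalAutomorphicRepData 2 ℚ hQ) (T : Literature.NumberTheory.Automorphic.InfinityType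 ℚ 2), π'.1.HasInfinityType T ∧ T.IsRegular ∧ T.IsLAlgebraic ∧ ∀ᶠ v : IsDedekindDomain.HeightOneSpectrum (NumberField.RingOfIntegers ℚ) in Filter.cofinite, ∃ (a : Multiset ℂ) (P : Polynomial (Valued.integer (PadicAlgCl 3))), π'.1.HasSatakeParamAt v a ∧ P.map (Valued.integer (PadicAlgCl 3)).subtype = Literature.NumberTheory.Automorphic.arithFrobPolyOfSatake ι v.residueCard 1 a ∧ τ.HasFrobCharpolyAt v (P.map red)) →
      OddResidualAutomorphyAtThree := by
  intro hA hB k _ _ _ _ _ τ hirr hodd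
  -- (1) data not named by X: an isomorphism ι : ℚ̄₃ ≃ ℂ (Steinitz), a residue map red : 𝒪_{ℚ̄₃} → k
  --     (constructed above) and the standard compact level structure
  obtain ⟨ι⟩ := PadicAlgCl.nonempty_ringEquiv_complex 3
  obtain ⟨red⟩ := ResidueMap.nonempty_residueMap k
  have hQ : isCompact_glFiniteIntegralLevel 2 ℚ := isCompact_glFiniteIntegralLevel_holds 2 ℚ
  -- (2) Serre–Khare–Wintenberger in the L-normalisation at p = 3 (piece X_A), repackaged
  obtain ⟨π, hLalg, hdat⟩ := hA 3 k red τ hodd hirr hQ ι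
  have hres : ∀ᶠ v : HeightOneSpectrum (NumberField.RingOfIntegers ℚ) in cofinite,
      ∃ (a : Multiset ℂ) (P : Polynomial (Valued.integer (PadicAlgCl 3))),
        π.1.HasSatakeParamAt v a ∧
          P.map (Valued.integer (PadicAlgCl 3)).subtype = arithFrobPolyOfSatake ι v.residueCard 1 a ∧
          τ.HasFrobCharpolyAt v (P.map red) := by
    filter_upwards [hdat] with v hv
    obtain ⟨a, P, Pb, ha, hP, -, hτ, hPb⟩ := hv
    exact ⟨a, P, ha, hP, hPb ▸ hτ⟩
  -- (3) weight raising at the fixed residue (piece X_B): a REGULAR L-algebraic π'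
  obtain ⟨π', T, hT, hreg, hLT, hres'⟩ := hB red ι τ hirr hodd hQ π hLalg hres
  -- (4) renormalise: contragredient, then ⊗ |det|^{1/2}
  obtain ⟨πc, hcSat, hcInf⟩ :=
    CuspidalAutomorphicRepData.exists_contragredient_satake_hasInfinityType_neg hQ π' hT
  obtain ⟨χ, πQ, hχ, hW, hW', hTQ⟩ :=
    CuspidalAutomorphicRepData.exists_twist_hasInfinityType πc (1 / 2 : ℝ) hcInf
  -- (5) the witness: πQ, O := ι(𝒪_{ℚ̄₃}), ι' := red ∘ ι⁻¹
  refine ⟨hQ, πQ, coeffSubring ι, red.comp (coeffEquiv ι).symm.toRingHom, ?_, ?_⟩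
  · -- regular algebraic: `T.neg.twist (1/2)` is C-algebraic (n = 2) and regular
    refine ⟨T.neg.twist (((1 / 2 : ℝ) : ℝ) : ℂ), hTQ, ?_, ?_⟩
    · intro σ p hp
      rw [InfinityType.twist_apply, Multiset.mem_map] at hp
      obtain ⟨w, hw, rfl⟩ := hp
      rw [InfinityType.neg_apply, Multiset.mem_map] at hw
      obtain ⟨w₀, hw₀, rfl⟩ := hw
      obtain ⟨m, l, hm, hl⟩ := hLT σ w₀ hw₀
      refine ⟨-m, -l, ?_, ?_⟩
      · simp only [ArchWeight.twist_a, ArchWeight.neg_a, hm]; push_cast; ring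
      · simp only [ArchWeight.twist_b, ArchWeight.neg_b, hl]; push_cast; ring
    · exact (hreg.neg).twist _
  · filter_upwards [hres'] with v hv
    obtain ⟨a, P, ha, hPa, hPτ⟩ := hv
    refine ⟨(a.map (·⁻¹)).map (((v.residueCard : ℂ) ^ (-(((1 / 2 : ℝ) : ℝ) : ℂ))) * ·),
      P.map (coeffEquiv ι).toRingHom, ?_, ?_, ?_⟩
    · -- Satake parameters of the renormalised representation: q^{-1/2} · a⁻¹
      exact AutomorphicRepData.HasSatakeParamAt.of_map_mulChar_detTwist_of_cpow hχ hW hW' (hcSat v a ha)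
    · -- ∏ (X - √q · (q^{-1/2} a_j⁻¹)) = ∏ (X - a_j⁻¹) = ι (arithFrobPolyOfSatake ι q 1 a) = ι(P)
      rw [Polynomial.map_map, subtype_comp_coeffEquiv, ← Polynomial.map_map, hPa,
        map_arithFrobPolyOfSatake_one, Multiset.map_map, Multiset.map_map]
      congr 1
      refine Multiset.map_congr rfl fun b _ => ?_
      simp only [Function.comp_apply]
      rw [← mul_assoc, sqrt_mul_cpow_neg_half (zero_lt_one.trans v.one_lt_residueCard), one_mul]
    · -- reduction along ι' = red ∘ ι⁻¹ of the transported polynomial is the reduction of P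
      have hcomp' : (red.comp (coeffEquiv ι).symm.toRingHom).comp (coeffEquiv ι).toRingHom = red := by
        ext x; simp
      rw [Polynomial.map_map, hcomp']
      exact hPτ


end Summit.Langlands.Langlands.Theorems.TrigonalHeartLimitOddResidualAutomorphyAtThreeSplit
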